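import Mathlib
import HarnessLib
import Summits.HubbardSuperconductivity.HubbardSuperconductivity.Theorems.KLProgrammeKLRegimeEngineV8TwoLegMomentsExportGrid
import Summits.HubbardSuperconductivity.HubbardSuperconductivity.Theorems.KLProgrammeKLRegimeEngineScaleZeroTwoLegGridSumsWeights
import Summits.HubbardSuperconductivity.HubbardSuperconductivity.Theorems.KLProgrammeKLRegimeEngineE4ScaleDoorBridge

/-!
# Route `KLProgramme` — ENGINE child gen 8 (stmt-HubbardSuperconductivity-20437 `KLRegimeEngineV17F2`), class #7 in GRID currency ((Y′)-GRID, plan g19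
# (R59o)/(R59ac)): the ASSEMBLY LAYER of deliverable W3 «plain-leg m = 2 read-out pass» — the scale TELESCOPE of the grid atom
# `TwoLegGridMomentsAt` from its n = 0 base and per-scale `klScaleWt`-weighted plain-pin increment masses, and the GRID increment identity
# (cell gate-hubbard-kl, seat hubbard-kl-k3c2-p3 g7)

WHAT THE (b)-CLOSER NEEDS TO READ BY NAME (r2d-p1 g8 KL STATUS 2026-08-27T19:14Z (2c); E1 successor r2d-p2 g7 19:17Z (R59x); pen 19:18Z (R59ac)(i)–(ii)).
The class-#7 export of record is `TwoLegGridFlowMomentsAt L M Zt Zs β U μ n` (p557865): the two pinned `4M`-GRID sums (circular-time first moment,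
off-diagonal `(1+|Δx̃₀|+|Δx̃₁|)` sum) of `kernel₂ (W_n[K_n] − 𝒩_{K_n,4M})`, `W_j[K] := effAction (S_{4M}ᵀ C^K_{>Λ_j} S_{4M}) (V_{4M} + 𝒩_{K,4M})`,
uniformly in `n`.  The one-shot tower delivers it scale by scale at the FIXED frame `K = K_n`: the n = 0 base (p557865 §3 at `K = 0`; p3/p1b's
`twoLeg_time_sum_le` / `twoLeg_offDiag_moment_one_sum_le` at any `K`) plus, for every `j < n`, a bound on the `klScaleWt L M β (j+1)`-weighted PLAIN
pinned grid sum of `kernel₂ (W_{j+1}[K] − W_j[K])` (E1 kit part 10 `towerTwoLegIncrement_le` read at the plain pin through the G1-L chain with the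
trivial prescription on the two output slots).  This file is the currency-exact glue between those per-scale masses and the atom:

* §1 GENERIC: `norm_le_norm_zero_add_sum_range_norm_sub` (`‖a n‖ ≤ ‖a 0‖ + Σ_{j<n} ‖a (j+1) − a j‖`), `sum_mul_norm_le_telescope`,
  `sum_mul_norm_le_of_telescope` (weighted sums of norms along a telescoping sequence, with budgets).
* §2 THE MODEL TELESCOPE **`twoLegGridMomentsAt_telescope`** (the CONCRETE-decomposition twin of r2d-p1's any-decomposition conversion
  `twoLegGridMomentsAt_of_increments`, `…ExportGridIncrements` p561837 — here the increments ARE the slice steps `W_{j+1}[K] − W_j[K]` and the base is the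
  atom at `(K, 0)`, so no decomposition hypothesis is left to the caller): `TwoLegGridMomentsAt L M Zt₀ Zs₀ β U μ K 0` and, for every `j < n`, the two
  rows of the atom (literal weights) for `kernel₂ (W_{j+1}[K] − W_j[K])` with budgets `bt j`, `bs j` (the counterterm `𝒩_{K,4M}` cancels in the
  increments) ⇒ `TwoLegGridMomentsAt L M (Zt₀ + Σ_{j<n} bt j) (Zs₀ + Σ_{j<n} bs j) β U μ K n`.
* §3 THE DOMINATION (r2d-p1's (2c) conversions, as Lean rows; `Λ_j = klScale klE0 j = klE0·4^{−j} ≤ 1`, `klScaleWt_j = 1 + Λ_j·diam`):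
  `timeWeight_le_klScale_inv_mul_klScaleWt` (`(β/N)·circDist_N(j₀,j₁) ≤ Λ_j⁻¹·klScaleWt_j`), `offDiagMomentWeight_le_two_mul_klScale_inv_mul_klScaleWt`
  (`[x⃗₁ ≠ x⃗₀](1+|Δx̃₀|+|Δx̃₁|) ≤ 2Λ_j⁻¹·klScaleWt_j`), their point-string forms, and the pinned-sum forms
  `time_pointSum_le_of_klScaleWt_pinnedSum` / `offDiag_pointSum_le_of_klScaleWt_pinnedSum`: a `klScaleWt_j`-weighted plain pinned grid sum `≤ B` of
  `kernel₂` of ANY grid element gives the time row `≤ Λ_j⁻¹·B` and the space row `≤ 2Λ_j⁻¹·B`.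
* §4 THE COMPOSITION **`twoLegGridMomentsAt_of_wtIncrements`** (base + `∀ j < n`, `klScaleWt (j+1)`-weighted pinned increment mass `≤ b j·U²·β/(2N)` ⇒
  the atom at `n` with `Zt = Zt₀ + Σ_{j<n} Λ_{j+1}⁻¹ b j`, `Zs = Zs₀ + 2·Σ_{j<n} Λ_{j+1}⁻¹ b j`), `…_of_sum_le` (one summed budget `Bw`), and the
  flow-frame forms **`twoLegGridFlowMomentsAt_of_wtIncrements[_of_sum_le]`** (THE EXPORT from base-at-`(K_n, 0)` + increments at `K_n`);
  `klScaleWt_succ_le` lets a supplier holding `klScaleWt j`-weighted masses feed the `klScaleWt (j+1)` slot.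
The GRID INCREMENT IDENTITY (the three pieces `W_{j+1}[K] − W_j[K]` splits into) is the sequel `…TwoLegGridIncrementRep`; W3's analytic half (the
weighted plain-pin sums of those pieces from the tower's sectorised data; the frame-`K` scale-0 base) is NOT here.  Everything here is PROVED; no
definitions; nothing about the model's sizes is asserted; nothing asserts superconductivity.
References: BGM 2006 §2.3 (2.17), §2.4 (2.36), §3 (3.2)–(3.3) [cite: BenfattoGiulianiMastropietro2006]; Salmhofer 1999 §2.5.1 (2.106), §4.3 (4.95)
[cite: Salmhofer1999].
-/

noncomputable section

namespace Summit.HubbardSuperconductivity.HubbardSuperconductivity.Theorems.EngineV8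

set_option linter.dupNamespace false -- summit = problem name (single-conjunct summit), D-0017

open Real Finset Literature.MathematicalPhysics.QuantumLattice Literature.Probability.LatticeModels
open Literature.Probability.LatticeModels.BattleFederbush GrassmannAlgebra
open Summit.HubbardSuperconductivity.HubbardSuperconductivity.Theorems.KLRegimeSplit
open Summit.HubbardSuperconductivity.HubbardSuperconductivity.Theorems.KLProgrammeLegKernels

/-! ## §1 Generic: weighted sums of norms along a telescoping sequence -/

section Generic

variable {ι E : Type*} [SeminormedAddCommGroup E]

/-- `‖a n‖ ≤ ‖a 0‖ + Σ_{j<n} ‖a (j+1) − a j‖`. -/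
theorem norm_le_norm_zero_add_sum_range_norm_sub (a : ℕ → E) (n : ℕ) :
    ‖a n‖ ≤ ‖a 0‖ + ∑ j ∈ range n, ‖a (j + 1) - a j‖ := by
  induction n with
  | zero => simp
  | succ n ih =>
    rw [sum_range_succ, ← add_assoc]
    exact (norm_le_norm_add_norm_sub' (a (n + 1)) (a n)).trans (by linarith)

/-- **Weighted sums of norms telescope**: for nonnegative weights `ω` on `s`,
`Σ_i ω_i‖a n i‖ ≤ Σ_i ω_i‖a 0 i‖ + Σ_{j<n} Σ_i ω_i‖a (j+1) i − a j i‖`. -/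
theorem sum_mul_norm_le_telescope (s : Finset ι) {ω : ι → ℝ} (hω : ∀ i ∈ s, 0 ≤ ω i) (a : ℕ → ι → E) (n : ℕ) :
    ∑ i ∈ s, ω i * ‖a n i‖ ≤ ∑ i ∈ s, ω i * ‖a 0 i‖ + ∑ j ∈ range n, ∑ i ∈ s, ω i * ‖a (j + 1) i - a j i‖ := by
  calc ∑ i ∈ s, ω i * ‖a n i‖ ≤ ∑ i ∈ s, ω i * (‖a 0 i‖ + ∑ j ∈ range n, ‖a (j + 1) i - a j i‖) :=
        sum_le_sum fun i hi => mul_le_mul_of_nonneg_left (norm_le_norm_zero_add_sum_range_norm_sub (fun j => a j i) n) (hω i hi)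
    _ = ∑ i ∈ s, ω i * ‖a 0 i‖ + ∑ i ∈ s, ∑ j ∈ range n, ω i * ‖a (j + 1) i - a j i‖ := by
        simp only [mul_add, mul_sum, sum_add_distrib]
    _ = _ := by rw [sum_comm]

/-- **The budget form**: `Σ_i ω_i‖a 0 i‖ ≤ B₀` and `Σ_i ω_i‖a (j+1) i − a j i‖ ≤ b j` for `j < n` give `Σ_i ω_i‖a n i‖ ≤ B₀ + Σ_{j<n} b j`. -/
theorem sum_mul_norm_le_of_telescope (s : Finset ι) {ω : ι → ℝ} (hω : ∀ i ∈ s, 0 ≤ ω i) (a : ℕ → ι → E) (n : ℕ)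
    {B₀ : ℝ} {b : ℕ → ℝ} (h0 : ∑ i ∈ s, ω i * ‖a 0 i‖ ≤ B₀) (hb : ∀ j < n, ∑ i ∈ s, ω i * ‖a (j + 1) i - a j i‖ ≤ b j) :
    ∑ i ∈ s, ω i * ‖a n i‖ ≤ B₀ + ∑ j ∈ range n, b j :=
  (sum_mul_norm_le_telescope s hω a n).trans (add_le_add h0 (sum_le_sum fun j hj => hb j (mem_range.1 hj)))

end Generic

/-! ## §2 The model telescope of the grid atom at a fixed frame -/

section Model

variable {L M : ℕ} [NeZero L] [NeZero M]

omit [NeZero M] in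
/-- **THE SCALE TELESCOPE OF THE GRID ATOM AT A FIXED FRAME** (`0 ≤ β`).  With `W_j[K] := effAction (S_{4M}ᵀ C^K_{>Λ_j} S_{4M}) (V_{4M} + 𝒩_{K,4M})`:
if `TwoLegGridMomentsAt L M Zt₀ Zs₀ β U μ K 0` and, for every `j < n`, both spins `σ` and every grid pin `p₀`,
(time) `Σ_{p₁} (β/N)·circDist_N(j₀,j₁)·‖kernel₂ (W_{j+1}[K] − W_j[K]) ((p₀,σ,+),(p₁,σ,−))‖ ≤ bt j·U²·β/(2N)` and
(space) `Σ_{p₁} [x⃗₁ ≠ x⃗₀](1+|Δx̃₀|+|Δx̃₁|)·‖kernel₂ (W_{j+1}[K] − W_j[K]) (…)‖ ≤ bs j·U²·β/(2N)`, then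
`TwoLegGridMomentsAt L M (Zt₀ + Σ_{j<n} bt j) (Zs₀ + Σ_{j<n} bs j) β U μ K n` (the counterterm cancels in every increment). -/
theorem twoLegGridMomentsAt_telescope {Zt₀ Zs₀ β U μ : ℝ} {K : TrigPolyC4v} {n : ℕ} (bt bs : ℕ → ℝ) (hβ : 0 ≤ β)
    (h0 : TwoLegGridMomentsAt L M Zt₀ Zs₀ β U μ K 0)
    (hT : ∀ j < n, ∀ (σ : Fin 2) (p₀ : GridPoint L (2 * (2 * M))), ∑ p₁ : GridPoint L (2 * (2 * M)),
      β / ((2 * (2 * M) : ℕ) : ℝ) * (circDist (2 * (2 * M)) p₀.1.val p₁.1.val : ℝ) *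
        ‖kernel ℂ
          (effAction ℂ ((hubbardGridSub L M β (2 * (2 * M))).transpose *
              hubbardCovAboveCT L M β μ 0 K (klScale klE0 (j + 1)) * hubbardGridSub L M β (2 * (2 * M)))
            (hubbardGridInteraction L (2 * (2 * M)) β U + hubbardGridCounterQuadratic L (2 * (2 * M)) β K) -
          effAction ℂ ((hubbardGridSub L M β (2 * (2 * M))).transpose *
              hubbardCovAboveCT L M β μ 0 K (klScale klE0 j) * hubbardGridSub L M β (2 * (2 * M)))
            (hubbardGridInteraction L (2 * (2 * M)) β U + hubbardGridCounterQuadratic L (2 * (2 * M)) β K)) 2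
          (fun i => ((![p₀, p₁] i, σ), i))‖ ≤ bt j * U ^ 2 * (β / (2 * ((2 * (2 * M) : ℕ) : ℝ))))
    (hS : ∀ j < n, ∀ (σ : Fin 2) (p₀ : GridPoint L (2 * (2 * M))), ∑ p₁ : GridPoint L (2 * (2 * M)),
      (if p₁.2 - p₀.2 = 0 then (0 : ℝ) else
        (1 + (((p₁.2 - p₀.2) 0).valMinAbs.natAbs : ℝ) + (((p₁.2 - p₀.2) 1).valMinAbs.natAbs : ℝ)) ^ 1) *
        ‖kernel ℂ
          (effAction ℂ ((hubbardGridSub L M β (2 * (2 * M))).transpose *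
              hubbardCovAboveCT L M β μ 0 K (klScale klE0 (j + 1)) * hubbardGridSub L M β (2 * (2 * M)))
            (hubbardGridInteraction L (2 * (2 * M)) β U + hubbardGridCounterQuadratic L (2 * (2 * M)) β K) -
          effAction ℂ ((hubbardGridSub L M β (2 * (2 * M))).transpose *
              hubbardCovAboveCT L M β μ 0 K (klScale klE0 j) * hubbardGridSub L M β (2 * (2 * M)))
            (hubbardGridInteraction L (2 * (2 * M)) β U + hubbardGridCounterQuadratic L (2 * (2 * M)) β K)) 2
          (fun i => ((![p₀, p₁] i, σ), i))‖ ≤ bs j * U ^ 2 * (β / (2 * ((2 * (2 * M) : ℕ) : ℝ)))) :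
    TwoLegGridMomentsAt L M (Zt₀ + ∑ j ∈ range n, bt j) (Zs₀ + ∑ j ∈ range n, bs j) β U μ K n := by
  refine ⟨fun σ p₀ => ?_, fun σ p₀ => ?_⟩
  · have h := sum_mul_norm_le_of_telescope (E := ℂ) univ
      (ω := fun p₁ : GridPoint L (2 * (2 * M)) => β / ((2 * (2 * M) : ℕ) : ℝ) * (circDist (2 * (2 * M)) p₀.1.val p₁.1.val : ℝ))
      (fun p₁ _ => mul_nonneg (div_nonneg hβ (Nat.cast_nonneg _)) (Nat.cast_nonneg _))
      (fun j p₁ => kernel ℂ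
        (effAction ℂ ((hubbardGridSub L M β (2 * (2 * M))).transpose *
            hubbardCovAboveCT L M β μ 0 K (klScale klE0 j) * hubbardGridSub L M β (2 * (2 * M)))
          (hubbardGridInteraction L (2 * (2 * M)) β U + hubbardGridCounterQuadratic L (2 * (2 * M)) β K) -
          hubbardGridCounterQuadratic L (2 * (2 * M)) β K) 2 (fun i => ((![p₀, p₁] i, σ), i)))
      n (B₀ := Zt₀ * U ^ 2 * (β / (2 * ((2 * (2 * M) : ℕ) : ℝ)))) (b := fun j => bt j * U ^ 2 * (β / (2 * ((2 * (2 * M) : ℕ) : ℝ))))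
      (h0.1 σ p₀) (fun j hj => by simpa only [← kernel_sub', sub_sub_sub_cancel_right] using hT j hj σ p₀)
    refine h.trans (le_of_eq ?_)
    rw [add_mul, add_mul, sum_mul, sum_mul]
  · have h := sum_mul_norm_le_of_telescope (E := ℂ) univ
      (ω := fun p₁ : GridPoint L (2 * (2 * M)) => (if p₁.2 - p₀.2 = 0 then (0 : ℝ) else
        (1 + (((p₁.2 - p₀.2) 0).valMinAbs.natAbs : ℝ) + (((p₁.2 - p₀.2) 1).valMinAbs.natAbs : ℝ)) ^ 1))
      (fun p₁ _ => by split_ifs <;> positivity)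
      (fun j p₁ => kernel ℂ
        (effAction ℂ ((hubbardGridSub L M β (2 * (2 * M))).transpose *
            hubbardCovAboveCT L M β μ 0 K (klScale klE0 j) * hubbardGridSub L M β (2 * (2 * M)))
          (hubbardGridInteraction L (2 * (2 * M)) β U + hubbardGridCounterQuadratic L (2 * (2 * M)) β K) -
          hubbardGridCounterQuadratic L (2 * (2 * M)) β K) 2 (fun i => ((![p₀, p₁] i, σ), i)))
      n (B₀ := Zs₀ * U ^ 2 * (β / (2 * ((2 * (2 * M) : ℕ) : ℝ)))) (b := fun j => bs j * U ^ 2 * (β / (2 * ((2 * (2 * M) : ℕ) : ℝ))))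
      (h0.2 σ p₀) (fun j hj => by simpa only [← kernel_sub', sub_sub_sub_cancel_right] using hS j hj σ p₀)
    refine h.trans (le_of_eq ?_)
    rw [add_mul, add_mul, sum_mul, sum_mul]

/-! ## §3 The domination of the atom's two pair weights by the scale-`j` tree weight -/

omit [NeZero L] in
/-- **The circular grid time distance is dominated by the scale-`j` weight**: for a grid two-string `Y`,
`(β/N)·circDist_N(j₀, j₁) ≤ Λ_j⁻¹ · klScaleWt L M β j ((image Y).image gridLegPos)` (indeed `≤ Λ_j⁻¹·(klScaleWt_j − 1) = diam`). -/
theorem timeWeight_le_klScale_inv_mul_klScaleWt (β : ℝ) (j : ℕ) (Y : Fin 2 → GridLeg (GridPoint L (2 * (2 * M)))) :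
    β / ((2 * (2 * M) : ℕ) : ℝ) * (circDist (2 * (2 * M)) (Y 0).1.1.1.val (Y 1).1.1.1.val : ℝ) ≤
      (klScale klE0 j)⁻¹ * klScaleWt L M β j ((univ.image Y).image gridLegPos) := by
  haveI : NeZero (2 * (2 * M)) := ⟨by have := NeZero.ne M; omega⟩
  have hΛ := klth_klScale_pos j
  have hd : gridLabelDist L (2 * (2 * M)) β (gridLegPos (Y 0)) (gridLegPos (Y 1)) ≤
      labelDiam (gridLabelDist L (2 * (2 * M)) β) ((univ.image Y).image gridLegPos) := by
    rw [Finset.image_image]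
    exact le_labelDiam _ (mem_image_of_mem _ (mem_univ 0)) (mem_image_of_mem _ (mem_univ 1))
  have ht := timeDist_le_gridLabelDist_gridLegPos (L := L) (N := 2 * (2 * M)) β Y
  have heq : (klScale klE0 j)⁻¹ * klScaleWt L M β j ((univ.image Y).image gridLegPos) =
      (klScale klE0 j)⁻¹ + labelDiam (gridLabelDist L (2 * (2 * M)) β) ((univ.image Y).image gridLegPos) := by
    rw [klScaleWt_apply]
    field_simp
  rw [heq]
  have hinv : 0 ≤ (klScale klE0 j)⁻¹ := inv_nonneg.2 hΛ.le
  linarith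

/-- **The off-diagonal first-moment weight is dominated by twice the scale-`j` weight**:
`[x⃗₁ ≠ x⃗₀](1 + |Δx̃₀| + |Δx̃₁|) ≤ 2·Λ_j⁻¹·klScaleWt L M β j ((image Y).image gridLegPos)` (`0 ≤ β`; uses `Λ_j ≤ 1`). -/
theorem offDiagMomentWeight_le_two_mul_klScale_inv_mul_klScaleWt {β : ℝ} (hβ : 0 ≤ β) (j : ℕ)
    (Y : Fin 2 → GridLeg (GridPoint L (2 * (2 * M)))) :
    (if (Y 1).1.1.2 - (Y 0).1.1.2 = 0 then (0 : ℝ) else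
      (1 + ((((Y 1).1.1.2 - (Y 0).1.1.2) 0).valMinAbs.natAbs : ℝ) + ((((Y 1).1.1.2 - (Y 0).1.1.2) 1).valMinAbs.natAbs : ℝ)) ^ 1) ≤
      2 * ((klScale klE0 j)⁻¹ * klScaleWt L M β j ((univ.image Y).image gridLegPos)) := by
  haveI : NeZero (2 * (2 * M)) := ⟨by have := NeZero.ne M; omega⟩
  have hΛ := klth_klScale_pos j
  have h0 := natAbs_valMinAbs_sub_le_torusSiteDist (Y 0).1.1.2 (Y 1).1.1.2 0
  have h1 := natAbs_valMinAbs_sub_le_torusSiteDist (Y 0).1.1.2 (Y 1).1.1.2 1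
  have hd : torusSiteDist (Y 0).1.1.2 (Y 1).1.1.2 ≤ labelDiam (gridLabelDist L (2 * (2 * M)) β) ((univ.image Y).image gridLegPos) := by
    refine (torusSiteDist_le_gridLabelDist_gridLegPos hβ Y).trans ?_
    rw [Finset.image_image]
    exact le_labelDiam _ (mem_image_of_mem _ (mem_univ 0)) (mem_image_of_mem _ (mem_univ 1))
  have hD0 : 0 ≤ labelDiam (gridLabelDist L (2 * (2 * M)) β) ((univ.image Y).image gridLegPos) := labelDiam_nonneg _ _
  have hinv1 : 1 ≤ (klScale klE0 j)⁻¹ := one_le_inv₀ hΛ |>.2 (klScale_klE0_le_one j)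
  have heq : (klScale klE0 j)⁻¹ * klScaleWt L M β j ((univ.image Y).image gridLegPos) =
      (klScale klE0 j)⁻¹ + labelDiam (gridLabelDist L (2 * (2 * M)) β) ((univ.image Y).image gridLegPos) := by
    rw [klScaleWt_apply]
    field_simp
  rw [heq]
  split_ifs
  · positivity
  · rw [pow_one]
    linarith

omit [NeZero L] in
/-- Point-string form of `timeWeight_le_klScale_inv_mul_klScaleWt` (the atom's time weight at the string `((p₀,σ,+),(p₁,σ,−))`). -/
theorem timeWeight_point_le_klScale_inv_mul_klScaleWt (β : ℝ) (j : ℕ) (σ : Fin 2) (p₀ p₁ : GridPoint L (2 * (2 * M))) :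
    β / ((2 * (2 * M) : ℕ) : ℝ) * (circDist (2 * (2 * M)) p₀.1.val p₁.1.val : ℝ) ≤
      (klScale klE0 j)⁻¹ * klScaleWt L M β j
        ((univ.image (fun i : Fin 2 => (((![p₀, p₁] i, σ), i) : GridLeg (GridPoint L (2 * (2 * M)))))).image gridLegPos) := by
  have h := timeWeight_le_klScale_inv_mul_klScaleWt (L := L) (M := M) β j (fun i : Fin 2 => (((![p₀, p₁] i, σ), i)))
  simpa only [Matrix.cons_val_zero, Matrix.cons_val_one, Matrix.cons_val_fin_one] using h

/-- Point-string form of `offDiagMomentWeight_le_two_mul_klScale_inv_mul_klScaleWt`. -/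
theorem offDiagMomentWeight_point_le_two_mul_klScale_inv_mul_klScaleWt {β : ℝ} (hβ : 0 ≤ β) (j : ℕ) (σ : Fin 2)
    (p₀ p₁ : GridPoint L (2 * (2 * M))) :
    (if p₁.2 - p₀.2 = 0 then (0 : ℝ) else
      (1 + (((p₁.2 - p₀.2) 0).valMinAbs.natAbs : ℝ) + (((p₁.2 - p₀.2) 1).valMinAbs.natAbs : ℝ)) ^ 1) ≤
      2 * ((klScale klE0 j)⁻¹ * klScaleWt L M β j
        ((univ.image (fun i : Fin 2 => (((![p₀, p₁] i, σ), i) : GridLeg (GridPoint L (2 * (2 * M)))))).image gridLegPos)) := by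
  have h := offDiagMomentWeight_le_two_mul_klScale_inv_mul_klScaleWt (L := L) (M := M) hβ j (fun i : Fin 2 => (((![p₀, p₁] i, σ), i)))
  simpa only [Matrix.cons_val_zero, Matrix.cons_val_one, Matrix.cons_val_fin_one] using h

/-- **TIME ROW FROM A WEIGHTED PLAIN PINNED SUM**: for ANY grid element `D`, if the `klScaleWt_j`-weighted pinned sum
`Σ_{Y : Y 0 = ((p₀,σ),+)} klScaleWt_j((image Y).image gridLegPos)·‖kernel₂ D Y‖ ≤ B`, then
`Σ_{p₁} (β/N)·circDist_N(j₀,j₁)·‖kernel₂ D ((p₀,σ,+),(p₁,σ,−))‖ ≤ Λ_j⁻¹·B` (`0 ≤ β`). -/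
theorem time_pointSum_le_of_klScaleWt_pinnedSum (β : ℝ) (j : ℕ) (D : GrassmannAlgebra ℂ (GridLeg (GridPoint L (2 * (2 * M)))))
    (σ : Fin 2) (p₀ : GridPoint L (2 * (2 * M))) {B : ℝ}
    (hB : ∑ Y ∈ univ.filter (fun Y : Fin 2 → GridLeg (GridPoint L (2 * (2 * M))) => Y 0 = ((p₀, σ), 0)),
      klScaleWt L M β j ((univ.image Y).image gridLegPos) * ‖kernel ℂ D 2 Y‖ ≤ B) :
    ∑ p₁ : GridPoint L (2 * (2 * M)), β / ((2 * (2 * M) : ℕ) : ℝ) * (circDist (2 * (2 * M)) p₀.1.val p₁.1.val : ℝ) *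
        ‖kernel ℂ D 2 (fun i => ((![p₀, p₁] i, σ), i))‖ ≤ (klScale klE0 j)⁻¹ * B := by
  have hinv : 0 ≤ (klScale klE0 j)⁻¹ := inv_nonneg.2 (klth_klScale_pos j).le
  have hw0 : ∀ Y : Fin 2 → GridLeg (GridPoint L (2 * (2 * M))), 0 ≤ (klScale klE0 j)⁻¹ * klScaleWt L M β j ((univ.image Y).image gridLegPos) :=
    fun Y => mul_nonneg hinv (zero_le_one.trans (one_le_klScaleWt L M β j _))
  calc ∑ p₁ : GridPoint L (2 * (2 * M)), β / ((2 * (2 * M) : ℕ) : ℝ) * (circDist (2 * (2 * M)) p₀.1.val p₁.1.val : ℝ) *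
          ‖kernel ℂ D 2 (fun i => ((![p₀, p₁] i, σ), i))‖
      ≤ ∑ p₁ : GridPoint L (2 * (2 * M)), (klScale klE0 j)⁻¹ * klScaleWt L M β j
          ((univ.image (fun i : Fin 2 => (((![p₀, p₁] i, σ), i) : GridLeg (GridPoint L (2 * (2 * M)))))).image gridLegPos) *
          ‖kernel ℂ D 2 (fun i => ((![p₀, p₁] i, σ), i))‖ :=
        sum_le_sum fun p₁ _ => mul_le_mul_of_nonneg_right (timeWeight_point_le_klScale_inv_mul_klScaleWt β j σ p₀ p₁) (norm_nonneg _)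
    _ ≤ ∑ Y ∈ univ.filter (fun Y : Fin 2 → GridLeg (GridPoint L (2 * (2 * M))) => Y 0 = ((p₀, σ), 0)),
          (klScale klE0 j)⁻¹ * klScaleWt L M β j ((univ.image Y).image gridLegPos) * ‖kernel ℂ D 2 Y‖ :=
        sum_point_string_le_sum_pinned (fun Y => (klScale klE0 j)⁻¹ * klScaleWt L M β j ((univ.image Y).image gridLegPos) * ‖kernel ℂ D 2 Y‖)
          (fun Y => mul_nonneg (hw0 Y) (norm_nonneg _)) σ p₀
    _ = (klScale klE0 j)⁻¹ * ∑ Y ∈ univ.filter (fun Y : Fin 2 → GridLeg (GridPoint L (2 * (2 * M))) => Y 0 = ((p₀, σ), 0)),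
          klScaleWt L M β j ((univ.image Y).image gridLegPos) * ‖kernel ℂ D 2 Y‖ := by
        rw [mul_sum]
        exact sum_congr rfl fun Y _ => mul_assoc _ _ _
    _ ≤ (klScale klE0 j)⁻¹ * B := mul_le_mul_of_nonneg_left hB hinv

/-- **SPACE ROW FROM A WEIGHTED PLAIN PINNED SUM**: for ANY grid element `D`, the same `klScaleWt_j`-weighted pinned sum `≤ B` gives
`Σ_{p₁} [x⃗₁ ≠ x⃗₀](1+|Δx̃₀|+|Δx̃₁|)·‖kernel₂ D ((p₀,σ,+),(p₁,σ,−))‖ ≤ 2Λ_j⁻¹·B` (`0 ≤ β`). -/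
theorem offDiag_pointSum_le_of_klScaleWt_pinnedSum {β : ℝ} (hβ : 0 ≤ β) (j : ℕ) (D : GrassmannAlgebra ℂ (GridLeg (GridPoint L (2 * (2 * M)))))
    (σ : Fin 2) (p₀ : GridPoint L (2 * (2 * M))) {B : ℝ}
    (hB : ∑ Y ∈ univ.filter (fun Y : Fin 2 → GridLeg (GridPoint L (2 * (2 * M))) => Y 0 = ((p₀, σ), 0)),
      klScaleWt L M β j ((univ.image Y).image gridLegPos) * ‖kernel ℂ D 2 Y‖ ≤ B) :
    ∑ p₁ : GridPoint L (2 * (2 * M)), (if p₁.2 - p₀.2 = 0 then (0 : ℝ) else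
        (1 + (((p₁.2 - p₀.2) 0).valMinAbs.natAbs : ℝ) + (((p₁.2 - p₀.2) 1).valMinAbs.natAbs : ℝ)) ^ 1) *
        ‖kernel ℂ D 2 (fun i => ((![p₀, p₁] i, σ), i))‖ ≤ 2 * (klScale klE0 j)⁻¹ * B := by
  have hinv : 0 ≤ (klScale klE0 j)⁻¹ := inv_nonneg.2 (klth_klScale_pos j).le
  have hw0 : ∀ Y : Fin 2 → GridLeg (GridPoint L (2 * (2 * M))),
      0 ≤ 2 * ((klScale klE0 j)⁻¹ * klScaleWt L M β j ((univ.image Y).image gridLegPos)) :=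
    fun Y => mul_nonneg zero_le_two (mul_nonneg hinv (zero_le_one.trans (one_le_klScaleWt L M β j _)))
  calc ∑ p₁ : GridPoint L (2 * (2 * M)), (if p₁.2 - p₀.2 = 0 then (0 : ℝ) else
          (1 + (((p₁.2 - p₀.2) 0).valMinAbs.natAbs : ℝ) + (((p₁.2 - p₀.2) 1).valMinAbs.natAbs : ℝ)) ^ 1) *
          ‖kernel ℂ D 2 (fun i => ((![p₀, p₁] i, σ), i))‖
      ≤ ∑ p₁ : GridPoint L (2 * (2 * M)), 2 * ((klScale klE0 j)⁻¹ * klScaleWt L M β j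
          ((univ.image (fun i : Fin 2 => (((![p₀, p₁] i, σ), i) : GridLeg (GridPoint L (2 * (2 * M)))))).image gridLegPos)) *
          ‖kernel ℂ D 2 (fun i => ((![p₀, p₁] i, σ), i))‖ :=
        sum_le_sum fun p₁ _ => mul_le_mul_of_nonneg_right
          (offDiagMomentWeight_point_le_two_mul_klScale_inv_mul_klScaleWt hβ j σ p₀ p₁) (norm_nonneg _)
    _ ≤ ∑ Y ∈ univ.filter (fun Y : Fin 2 → GridLeg (GridPoint L (2 * (2 * M))) => Y 0 = ((p₀, σ), 0)),
          2 * ((klScale klE0 j)⁻¹ * klScaleWt L M β j ((univ.image Y).image gridLegPos)) * ‖kernel ℂ D 2 Y‖ :=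
        sum_point_string_le_sum_pinned
          (fun Y => 2 * ((klScale klE0 j)⁻¹ * klScaleWt L M β j ((univ.image Y).image gridLegPos)) * ‖kernel ℂ D 2 Y‖)
          (fun Y => mul_nonneg (hw0 Y) (norm_nonneg _)) σ p₀
    _ = 2 * (klScale klE0 j)⁻¹ * ∑ Y ∈ univ.filter (fun Y : Fin 2 → GridLeg (GridPoint L (2 * (2 * M))) => Y 0 = ((p₀, σ), 0)),
          klScaleWt L M β j ((univ.image Y).image gridLegPos) * ‖kernel ℂ D 2 Y‖ := by
        rw [mul_sum]
        exact sum_congr rfl fun Y _ => by ring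
    _ ≤ 2 * (klScale klE0 j)⁻¹ * B := mul_le_mul_of_nonneg_left hB (mul_nonneg zero_le_two hinv)

omit [NeZero L] [NeZero M] in
/-- **A coarser weight dominates a finer one**: `klScaleWt L M β (j+1) S ≤ klScaleWt L M β j S` (`Λ_{j+1} ≤ Λ_j`), so a supplier holding
`klScaleWt j`-weighted masses may feed the `klScaleWt (j+1)` slots below. -/
theorem klScaleWt_succ_le (β : ℝ) (j : ℕ) (S : Finset (ZMod (2 * (2 * M)) × TorusSite 2 L)) :
    klScaleWt L M β (j + 1) S ≤ klScaleWt L M β j S := by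
  rw [klScaleWt_apply, klScaleWt_apply]
  have hD := labelDiam_nonneg (gridLabelDist L (2 * (2 * M)) β) S
  have h4 : klScale klE0 j = 4 * klScale klE0 (j + 1) := by
    simp only [klScale, pow_succ, mul_inv]
    ring
  have hΛ : klScale klE0 (j + 1) ≤ klScale klE0 j := by
    rw [h4]
    have := (klth_klScale_pos (j + 1)).le
    linarith
  nlinarith

/-! ## §4 The composition: the atom at scale `n` from the base and weighted plain-pin increment masses -/

/-- **THE GRID ATOM AT SCALE `n` FROM ITS BASE AND THE WEIGHTED INCREMENT MASSES** (`0 ≤ β`).  With `W_j[K]` as in `twoLegGridMomentsAt_telescope`: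
if `TwoLegGridMomentsAt L M Zt₀ Zs₀ β U μ K 0` and, for every `j < n` and every pinned grid leg `w`,
`Σ_{Y : Y 0 = w} klScaleWt L M β (j+1) ((image Y).image gridLegPos)·‖kernel₂ (W_{j+1}[K] − W_j[K]) Y‖ ≤ b j·U²·β/(2N)`, then
`TwoLegGridMomentsAt L M (Zt₀ + Σ_{j<n} Λ_{j+1}⁻¹·b j) (Zs₀ + Σ_{j<n} 2Λ_{j+1}⁻¹·b j) β U μ K n` (`Λ_{j+1}⁻¹ = 4^{j+1}/klE0`). -/
theorem twoLegGridMomentsAt_of_wtIncrements {Zt₀ Zs₀ β U μ : ℝ} {K : TrigPolyC4v} {n : ℕ} (b : ℕ → ℝ) (hβ : 0 ≤ β)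
    (h0 : TwoLegGridMomentsAt L M Zt₀ Zs₀ β U μ K 0)
    (hb : ∀ j < n, ∀ w : GridLeg (GridPoint L (2 * (2 * M))),
      ∑ Y ∈ univ.filter (fun Y : Fin 2 → GridLeg (GridPoint L (2 * (2 * M))) => Y 0 = w),
        klScaleWt L M β (j + 1) ((univ.image Y).image gridLegPos) *
          ‖kernel ℂ
            (effAction ℂ ((hubbardGridSub L M β (2 * (2 * M))).transpose *
                hubbardCovAboveCT L M β μ 0 K (klScale klE0 (j + 1)) * hubbardGridSub L M β (2 * (2 * M)))
              (hubbardGridInteraction L (2 * (2 * M)) β U + hubbardGridCounterQuadratic L (2 * (2 * M)) β K) -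
            effAction ℂ ((hubbardGridSub L M β (2 * (2 * M))).transpose *
                hubbardCovAboveCT L M β μ 0 K (klScale klE0 j) * hubbardGridSub L M β (2 * (2 * M)))
              (hubbardGridInteraction L (2 * (2 * M)) β U + hubbardGridCounterQuadratic L (2 * (2 * M)) β K)) 2 Y‖ ≤
        b j * U ^ 2 * (β / (2 * ((2 * (2 * M) : ℕ) : ℝ)))) :
    TwoLegGridMomentsAt L M (Zt₀ + ∑ j ∈ range n, (klScale klE0 (j + 1))⁻¹ * b j)
      (Zs₀ + ∑ j ∈ range n, 2 * (klScale klE0 (j + 1))⁻¹ * b j) β U μ K n := by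
  refine twoLegGridMomentsAt_telescope (fun j => (klScale klE0 (j + 1))⁻¹ * b j) (fun j => 2 * (klScale klE0 (j + 1))⁻¹ * b j) hβ h0
    (fun j hj σ p₀ => ?_) (fun j hj σ p₀ => ?_)
  · refine (time_pointSum_le_of_klScaleWt_pinnedSum β (j + 1) _ σ p₀ (hb j hj _)).trans (le_of_eq ?_)
    ring
  · refine (offDiag_pointSum_le_of_klScaleWt_pinnedSum hβ (j + 1) _ σ p₀ (hb j hj _)).trans (le_of_eq ?_)
    ring

/-- **SUMMED-BUDGET FORM**: as `twoLegGridMomentsAt_of_wtIncrements` with `Σ_{j<n} Λ_{j+1}⁻¹·b j ≤ Bw` ⇒ `TwoLegGridMomentsAt L M (Zt₀ + Bw) (Zs₀ + 2Bw) β U μ K n`. -/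
theorem twoLegGridMomentsAt_of_wtIncrements_of_sum_le {Zt₀ Zs₀ β U μ Bw : ℝ} {K : TrigPolyC4v} {n : ℕ} (b : ℕ → ℝ) (hβ : 0 ≤ β)
    (h0 : TwoLegGridMomentsAt L M Zt₀ Zs₀ β U μ K 0)
    (hb : ∀ j < n, ∀ w : GridLeg (GridPoint L (2 * (2 * M))),
      ∑ Y ∈ univ.filter (fun Y : Fin 2 → GridLeg (GridPoint L (2 * (2 * M))) => Y 0 = w),
        klScaleWt L M β (j + 1) ((univ.image Y).image gridLegPos) *
          ‖kernel ℂ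
            (effAction ℂ ((hubbardGridSub L M β (2 * (2 * M))).transpose *
                hubbardCovAboveCT L M β μ 0 K (klScale klE0 (j + 1)) * hubbardGridSub L M β (2 * (2 * M)))
              (hubbardGridInteraction L (2 * (2 * M)) β U + hubbardGridCounterQuadratic L (2 * (2 * M)) β K) -
            effAction ℂ ((hubbardGridSub L M β (2 * (2 * M))).transpose *
                hubbardCovAboveCT L M β μ 0 K (klScale klE0 j) * hubbardGridSub L M β (2 * (2 * M)))
              (hubbardGridInteraction L (2 * (2 * M)) β U + hubbardGridCounterQuadratic L (2 * (2 * M)) β K)) 2 Y‖ ≤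
        b j * U ^ 2 * (β / (2 * ((2 * (2 * M) : ℕ) : ℝ))))
    (hsum : ∑ j ∈ range n, (klScale klE0 (j + 1))⁻¹ * b j ≤ Bw) :
    TwoLegGridMomentsAt L M (Zt₀ + Bw) (Zs₀ + 2 * Bw) β U μ K n := by
  refine (twoLegGridMomentsAt_of_wtIncrements b hβ h0 hb).mono hβ (by linarith) ?_
  have : ∑ j ∈ range n, 2 * (klScale klE0 (j + 1))⁻¹ * b j = 2 * ∑ j ∈ range n, (klScale klE0 (j + 1))⁻¹ * b j := by
    rw [mul_sum]
    exact sum_congr rfl fun j _ => mul_assoc _ _ _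
  rw [this]
  linarith

/-- **THE CLASS-#7 EXPORT FROM THE TOWER'S PER-SCALE MASSES AT THE FLOW FRAME** (`0 ≤ β`): with `K_n := klFlowFrameU L M β U μ n`, the base
`TwoLegGridMomentsAt L M Zt₀ Zs₀ β U μ K_n 0` and the `klScaleWt (j+1)`-weighted plain-pin increment masses `b j` at `K_n` for `j < n` give
`TwoLegGridFlowMomentsAt L M (Zt₀ + Σ_{j<n} Λ_{j+1}⁻¹·b j) (Zs₀ + Σ_{j<n} 2Λ_{j+1}⁻¹·b j) β U μ n`. -/
theorem twoLegGridFlowMomentsAt_of_wtIncrements {Zt₀ Zs₀ β U μ : ℝ} {n : ℕ} (b : ℕ → ℝ) (hβ : 0 ≤ β)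
    (h0 : TwoLegGridMomentsAt L M Zt₀ Zs₀ β U μ (klFlowFrameU L M β U μ n) 0)
    (hb : ∀ j < n, ∀ w : GridLeg (GridPoint L (2 * (2 * M))),
      ∑ Y ∈ univ.filter (fun Y : Fin 2 → GridLeg (GridPoint L (2 * (2 * M))) => Y 0 = w),
        klScaleWt L M β (j + 1) ((univ.image Y).image gridLegPos) *
          ‖kernel ℂ
            (effAction ℂ ((hubbardGridSub L M β (2 * (2 * M))).transpose *
                hubbardCovAboveCT L M β μ 0 (klFlowFrameU L M β U μ n) (klScale klE0 (j + 1)) * hubbardGridSub L M β (2 * (2 * M)))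
              (hubbardGridInteraction L (2 * (2 * M)) β U + hubbardGridCounterQuadratic L (2 * (2 * M)) β (klFlowFrameU L M β U μ n)) -
            effAction ℂ ((hubbardGridSub L M β (2 * (2 * M))).transpose *
                hubbardCovAboveCT L M β μ 0 (klFlowFrameU L M β U μ n) (klScale klE0 j) * hubbardGridSub L M β (2 * (2 * M)))
              (hubbardGridInteraction L (2 * (2 * M)) β U + hubbardGridCounterQuadratic L (2 * (2 * M)) β (klFlowFrameU L M β U μ n))) 2 Y‖ ≤
        b j * U ^ 2 * (β / (2 * ((2 * (2 * M) : ℕ) : ℝ)))) :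
    TwoLegGridFlowMomentsAt L M (Zt₀ + ∑ j ∈ range n, (klScale klE0 (j + 1))⁻¹ * b j)
      (Zs₀ + ∑ j ∈ range n, 2 * (klScale klE0 (j + 1))⁻¹ * b j) β U μ n :=
  twoLegGridMomentsAt_of_wtIncrements b hβ h0 hb

/-- **SUMMED-BUDGET FORM OF THE EXPORT**: base at `(K_n, 0)` with `(Zt₀, Zs₀)`, increment masses `b j`, `Σ_{j<n} Λ_{j+1}⁻¹·b j ≤ Bw` ⇒
`TwoLegGridFlowMomentsAt L M (Zt₀ + Bw) (Zs₀ + 2Bw) β U μ n` — `n`-uniform as soon as `Zt₀, Zs₀, Bw` are. -/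
theorem twoLegGridFlowMomentsAt_of_wtIncrements_of_sum_le {Zt₀ Zs₀ β U μ Bw : ℝ} {n : ℕ} (b : ℕ → ℝ) (hβ : 0 ≤ β)
    (h0 : TwoLegGridMomentsAt L M Zt₀ Zs₀ β U μ (klFlowFrameU L M β U μ n) 0)
    (hb : ∀ j < n, ∀ w : GridLeg (GridPoint L (2 * (2 * M))),
      ∑ Y ∈ univ.filter (fun Y : Fin 2 → GridLeg (GridPoint L (2 * (2 * M))) => Y 0 = w),
        klScaleWt L M β (j + 1) ((univ.image Y).image gridLegPos) *
          ‖kernel ℂ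
            (effAction ℂ ((hubbardGridSub L M β (2 * (2 * M))).transpose *
                hubbardCovAboveCT L M β μ 0 (klFlowFrameU L M β U μ n) (klScale klE0 (j + 1)) * hubbardGridSub L M β (2 * (2 * M)))
              (hubbardGridInteraction L (2 * (2 * M)) β U + hubbardGridCounterQuadratic L (2 * (2 * M)) β (klFlowFrameU L M β U μ n)) -
            effAction ℂ ((hubbardGridSub L M β (2 * (2 * M))).transpose *
                hubbardCovAboveCT L M β μ 0 (klFlowFrameU L M β U μ n) (klScale klE0 j) * hubbardGridSub L M β (2 * (2 * M)))
              (hubbardGridInteraction L (2 * (2 * M)) β U + hubbardGridCounterQuadratic L (2 * (2 * M)) β (klFlowFrameU L M β U μ n))) 2 Y‖ ≤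
        b j * U ^ 2 * (β / (2 * ((2 * (2 * M) : ℕ) : ℝ))))
    (hsum : ∑ j ∈ range n, (klScale klE0 (j + 1))⁻¹ * b j ≤ Bw) :
    TwoLegGridFlowMomentsAt L M (Zt₀ + Bw) (Zs₀ + 2 * Bw) β U μ n :=
  twoLegGridMomentsAt_of_wtIncrements_of_sum_le b hβ h0 hb hsum

end Model

end Summit.HubbardSuperconductivity.HubbardSuperconductivity.Theorems.EngineV8

end
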